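import Literature.MathematicalPhysics.QuantumFieldTheory.Balaban1983to89.B11Thm1CarrierT
import Literature.MathematicalPhysics.QuantumFieldTheory.Balaban1983to89.Node00.BackgroundActionReg

/-!
# `Balaban1983to89.B11Thm1CarrierTReg` — [Balaban1985Variational] Theorem 1 (8) and its uniqueness clause AT THE SOCKET `B11Thm1CarrierT.varProblemT`
# ARE NODE 00's regularity-class-generic solvability ∕ uniqueness `Node00.UkExistsR ∕ UniqueUkOrbitR` AT THE (2)-CLASS FAMILY `Node00.regB11`
# (interface finding F7 RESOLVED by def-B's `Node00/BackgroundActionReg`: «re-read (0.21) over the (2)-class»)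

T. Bałaban, *The variational problem and background fields in renormalization group method for lattice gauge theories*, Commun. Math. Phys. **102**
(1985) 277–309 [Balaban1985Variational], Theorem 1 (8) p. 279, (2), (6) p. 278; [Balaban1987RG1] (0.21) p. 256, (1.1)–(1.2) p. 260.  Seat
`pub-ymgap-dag-n07-a` (gen 2; def-Z); the two bridge one-liners announced by seat `pub-ymgap-node00-def-B` ([NODE00-DEF-B-G2-FILED-1], its probe
`probe_reg_n07.lean`), landed in the N07 socket's namespace BY NAME over `Node00.BackgroundActionReg` (p419415: `RegClass`, `regB11`, `UkExistsR`,
`UniqueUkOrbitR`, `ukExistsR_regB11_iff`) and `B11Thm1CarrierT` (p417210: `varProblemT`, `exists8_iff`, `unique6_iff`).  THEOREMS ONLY (0 `def`, 0 `sorry`).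

WHAT IS PROVED.  **`exists8_iff_ukExistsR`** — (8) at the socket ⇔ `UkExistsR F N (regB11 F N) K k (B₃ε₁) V` (both sides are «a minimiser of the Wilson action
over `𝔘_k(B₃ε₁) ∩ {Ū^k = V}` exists»; `Iff.rfl` up to the two unfoldings); **`uniqueUkOrbitR_of_unique6`** — the socket's uniqueness clause (reading
D-n07a-1) at any admissible `a₀ ≥ B₃ε₁` gives `UniqueUkOrbitR F N (regB11 F N) K k (B₃ε₁) V` (one radius `ε := B₃ε₁ = ε₀`); `thm1At_socket_gives_G8a`
(from `B11Thm1.Thm1At C` at the socket: for `0 < ε₁ ≤ C.a₁` and `V` with (7), G₈a-1 and G₈a-2 at the (2)-class, radius `C.B₃·ε₁`).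
So a discharge of N07's Theorem-1 slot at a pin built on `varProblemT` FEEDS the ₈∕₉ layer's `UkExistsR ∕ UniqueUkOrbitR` at `𝓡 := regB11` BY NAME.

HONEST FRAMING: count-neutral bookkeeping; nothing of Bałaban's asserted (both sides are displayed, proved nowhere for `k ≥ 1`); N07 NOT discharged; one
finite four-torus programme at fixed `ε`; nothing continuum ∕ ℝ⁴ ∕ OS ∕ mass-gap ∕ Clay.
-/

noncomputable section

namespace Literature.MathematicalPhysics.QuantumFieldTheory.Balaban1983to89.B11Thm1CarrierTReg

open T4Continuum (T4Family)
open Node00 (SU regB11 UkExistsR UniqueUkOrbitR ukExistsR_regB11_iff)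
open B11Thm1 (Exists8 Unique6 Thm1At)
open B11Thm1CarrierT (RegCarrierT varProblemT exists8_iff unique6_iff)

variable {F : T4Family} {N : ℕ} [NeZero N] {K k : ℕ} (R : RegCarrierT F N K)

/-- **(8) AT THE SOCKET ⇔ G₈a-1 AT THE (2)-CLASS**: `Exists8 (varProblemT F N K k R) B₃ ε₁ V ↔ UkExistsR F N (regB11 F N) K k (B₃ε₁) V`.
[cite: Balaban1985Variational, Thm 1 (8) p.279; Balaban1987RG1, (1.1) p.260] -/
theorem exists8_iff_ukExistsR (B₃ ε₁ : ℝ) (V : GaugeField (F.P K) k (SU N)) :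
    Exists8 (varProblemT F N K k R) B₃ ε₁ V ↔ UkExistsR F N (regB11 F N) K k (B₃ * ε₁) V :=
  (exists8_iff R B₃ ε₁ V).trans ukExistsR_regB11_iff.symm

/-- **THE SOCKET's UNIQUENESS CLAUSE ⇒ G₈a-2 AT THE (2)-CLASS, one radius `ε := B₃ε₁ (≤ a₀)`**: any two minimisers over `𝔘_k(B₃ε₁) ∩ {Ū^k = V}` lie in
one residual orbit. [cite: Balaban1985Variational, Thm 1 p.279 («unique critical orbit in the space (6) if B₃ε₁ ≤ ε₀ and ε₀ ≤ a₀»); Balaban1987RG1, (1.1) p.260] -/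
theorem uniqueUkOrbitR_of_unique6 {a₀ B₃ ε₁ : ℝ} (hle : B₃ * ε₁ ≤ a₀) {V : GaugeField (F.P K) k (SU N)}
    (h6 : Unique6 (varProblemT F N K k R) a₀ B₃ ε₁ V) : UniqueUkOrbitR F N (regB11 F N) K k (B₃ * ε₁) V :=
  fun U₀ U₀' h₀ h₀' => (((unique6_iff R a₀ B₃ ε₁ V).1 h6) (B₃ * ε₁) le_rfl hle U₀ h₀).2.2 U₀' h₀'

/-- **Theorem 1 AT GIVEN CONSTANTS at the socket ⇒ G₈a-1 ∧ G₈a-2 at the (2)-class** for every `0 < ε₁ ≤ a₁` and every datum `V` with (7), radius `B₃ε₁`.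
[cite: Balaban1985Variational, Thm 1 p.279; Balaban1987RG1, (1.1) p.260] -/
theorem thm1At_socket_gives_G8a (C : B11Thm1.Consts) (h : Thm1At C (varProblemT F N K k R)) {ε₁ : ℝ} (hε₁ : 0 < ε₁) (hε₁a : ε₁ ≤ C.a₁)
    (V : GaugeField (F.P K) k (SU N)) (hV : PlaqSmall ε₁ V) :
    UkExistsR F N (regB11 F N) K k (C.B₃ * ε₁) V ∧ UniqueUkOrbitR F N (regB11 F N) K k (C.B₃ * ε₁) V := by
  obtain ⟨h8, h6, -⟩ := h ε₁ hε₁ hε₁a V hV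
  have hle : C.B₃ * ε₁ ≤ C.a₀ := by
    have h1 : C.B₃ * ε₁ ≤ C.B₃ * C.a₁ := mul_le_mul_of_nonneg_left hε₁a C.B₃_pos.le
    exact h1.trans C.B₃a₁_le
  exact ⟨(exists8_iff_ukExistsR R C.B₃ ε₁ V).1 h8, uniqueUkOrbitR_of_unique6 R hle h6⟩

end Literature.MathematicalPhysics.QuantumFieldTheory.Balaban1983to89.B11Thm1CarrierTReg
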